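import Literature.AnabelianGeometry.EtaleTheta.FrobenioidThetaDivisorSupportOrders

/-!
# [EtTh] §5, Proposition 5.3 (iv): the p.326 description of `Prime^csp ↠ Prime^ncsp` from the intersection theory of the chain
(GAP-LEDGER G-L2d4-2, part 1)

Mochizuki, *The étale theta function …*, Publ. RIMS **45** (2009)
[cite: MochizukiEtTh2009, Prop 5.3 proof p.326 (PDF p.100); §1 p.240 (PDF p.14)].
Seat abc-iut-L6-d1 (gen 3); proof-only, over the repaired data `DivisorSupportData'`
(`FrobenioidThetaDivisorSupportR.lean`) and the toolkit `FrobenioidThetaDivisorSupportOrders.lean`.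

WHAT IS PROVED (row G-L2d4-2, L2-lead ruling 2026-08-26T01:20:55Z: the two verbatim criteria of the printed
proof are to be PROVED from the structural intersection-theoretic hypothesis, which enters as an explicit
binder — here `DivisorSupportData'.PrincipalIffDegreeZero 𝔖` = [EtTh] §1 p.240 "these degrees determine an
isomorphism `Pic(𝔜_N) ⥲ ℤ^ℤ`"):
* `cspToNcspCriterion'_of_degree` — the p.326 sentence "the natural surjection of (iv) is obtained by mapping the
  prime determined by `a` to the prime determined by `n`" needs only the "principal ⇒ degrees vanish" half:
  the degree of `b − a − n` on the component `n` is `2·mult(n) + (cusp orders of b over n) − mult(a)·[a ↦ n]`,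
  positive unless the cusp `a` lies on `n`;
* `cspToNcspWitnessed'_of_principalIffDegreeZero` — at every cusp `𝔞 ↦ n_j` the configuration of p.326 exists:
  `a = 2·𝔞`, `b = 𝔠₁ + 𝔠₂` with `𝔠₁ ↦ n_{j−1}`, `𝔠₂ ↦ n_{j+1}` (cusps exist over every component: the surjection
  of (iv)), `n = n_j`; then `b − a ∼ n` ("`n` is linearly equivalent to … `n₁ + n₂ − a` … the multiplicities of
  `n₁, n₂` are equal to each other as well as to half the multiplicity of `a`", p.326) and `b − a` is cuspidally
  minimal because any cuspidal `y ∼ n` has a cusp over each of `n_{j−1}, n_j, n_{j+1}` in its support.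
HONEST FRAMING: implications between predicates on OUR typed data; the hypothesis `PrincipalIffDegreeZero` is
discharged by nobody here (owner of the genuine special fibre of `Ÿ`); no side taken on anything downstream;
typed ≠ proved for the genuine curve. -/

namespace Literature.AnabelianGeometry.EtaleTheta

open CategoryTheory
open Literature.AlgebraicGeometry.Frobenioids

universe w v v' u u'

namespace FrobenioidThetaDivisors

open scoped Classical

variable {C : Type u} [Category.{v} C] {D : Type u'} [Category.{v'} D] {𝔉 : ThetaFrobenioid.{w} C D}
variable {𝔓 : DivisorPrimeData 𝔉}


/-! ### The chain of components: shifts of the labels -/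

/-- Label of a shifted component. [cite: MochizukiEtTh2009, §1 p.239–240 (PDF pp.13–14)] -/
theorem ncspEquivZ_ncspShift (t : ℤ) (𝔫 : {p : Primes 𝔉.PhiAcirc // ¬ 𝔓.IsCuspidal p}) :
    𝔓.ncspEquivZ (ncspShift 𝔓 t 𝔫) = 𝔓.ncspEquivZ 𝔫 + t := by
  simp only [ncspShift, Equiv.apply_symm_apply]

/-- Shifting by `t` then `s`. [cite: MochizukiEtTh2009, §1 p.239–240 (PDF pp.13–14)] -/
theorem ncspShift_ncspShift (s t : ℤ) (𝔫 : {p : Primes 𝔉.PhiAcirc // ¬ 𝔓.IsCuspidal p}) :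
    ncspShift 𝔓 s (ncspShift 𝔓 t 𝔫) = ncspShift 𝔓 (t + s) 𝔫 := by
  apply 𝔓.ncspEquivZ.injective
  simp only [ncspEquivZ_ncspShift, add_assoc]

/-- `ncspShift t 𝔪 = 𝔫 ↔ 𝔪 = ncspShift (−t) 𝔫`. [cite: MochizukiEtTh2009, §1 p.239–240 (PDF pp.13–14)] -/
theorem ncspShift_eq_iff (t : ℤ) (𝔪 𝔫 : {p : Primes 𝔉.PhiAcirc // ¬ 𝔓.IsCuspidal p}) :
    ncspShift 𝔓 t 𝔪 = 𝔫 ↔ 𝔪 = ncspShift 𝔓 (-t) 𝔫 := by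
  constructor
  · rintro rfl; rw [ncspShift_ncspShift, add_neg_cancel]; apply 𝔓.ncspEquivZ.injective
    simp only [ncspEquivZ_ncspShift, add_zero]
  · rintro rfl; rw [ncspShift_ncspShift, neg_add_cancel]; apply 𝔓.ncspEquivZ.injective
    simp only [ncspEquivZ_ncspShift, add_zero]

/-- A non-zero shift moves every component. [cite: MochizukiEtTh2009, §1 p.239–240 (PDF pp.13–14)] -/
theorem ncspShift_ne_self {t : ℤ} (ht : t ≠ 0) (𝔫 : {p : Primes 𝔉.PhiAcirc // ¬ 𝔓.IsCuspidal p}) :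
    ncspShift 𝔓 t 𝔫 ≠ 𝔫 := by
  intro h
  have := congrArg 𝔓.ncspEquivZ h
  rw [ncspEquivZ_ncspShift] at this
  exact ht (by linarith)

/-- Distinct shifts give distinct components. [cite: MochizukiEtTh2009, §1 p.239–240 (PDF pp.13–14)] -/
theorem ncspShift_ne_ncspShift {s t : ℤ} (h : s ≠ t) (𝔫 : {p : Primes 𝔉.PhiAcirc // ¬ 𝔓.IsCuspidal p}) :
    ncspShift 𝔓 s 𝔫 ≠ ncspShift 𝔓 t 𝔫 := by
  intro h'
  have := congrArg 𝔓.ncspEquivZ h'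
  rw [ncspEquivZ_ncspShift, ncspEquivZ_ncspShift] at this
  exact h (by linarith)

/-- Cusps over distinct components are distinct. [cite: MochizukiEtTh2009, Prop 5.3 p.325 (PDF p.99)] -/
theorem cusp_ne_of_cspToNcsp_ne {𝔠 𝔡 : {p : Primes 𝔉.PhiAcirc // 𝔓.IsCuspidal p}}
    (h : 𝔓.cspToNcsp 𝔠 ≠ 𝔓.cspToNcsp 𝔡) : 𝔠.1 ≠ 𝔡.1 :=
  fun h' => h (by rw [Subtype.ext h'])

namespace DivisorSupportData'

variable (𝔖 : DivisorSupportData' 𝔓)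

/-! ### Degrees of prime log-divisors -/

/-- Degree on `𝔪` of a cuspidal element with a single coordinate `m` at the cusp `𝔞`: `m·[𝔞 ↦ 𝔪]`.
[cite: MochizukiEtTh2009, §1 p.240 (PDF p.14)] -/
theorem degOn_cusp (𝔪 : {p : Primes 𝔉.PhiAcirc // ¬ 𝔓.IsCuspidal p}) {𝔞 : Primes 𝔉.PhiAcirc} (h𝔞 : 𝔓.IsCuspidal 𝔞)
    {x : Algebra.GrothendieckGroup 𝔉.PhiAcirc} {m : ℚ}
    (hx𝔞 : 𝔖.ord 𝔞 x = m) (hx : ∀ 𝔮, 𝔮 ≠ 𝔞 → 𝔖.ord 𝔮 x = 0) :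
    𝔖.degOn 𝔪 x = m * (if 𝔪 = 𝔓.cspToNcsp ⟨𝔞, h𝔞⟩ then 1 else 0) := by
  have hcusp : 𝔖.IsCuspidalGp x := by
    intro 𝔭 h𝔭
    have h𝔭' : 𝔖.ord 𝔭 x ≠ 0 := (𝔖.mem_supp_iff 𝔭 x).mp h𝔭
    by_contra h; exact h𝔭' (hx 𝔭 fun h' => h (h' ▸ h𝔞))
  rw [degOn_eq, 𝔖.vert_eq_zero_of_isCuspidalGp 𝔪 hcusp, 𝔖.cuspSum_of_cusp 𝔪 h𝔞 hx𝔞 hx, zero_add,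
    mul_boole]
  rcases eq_or_ne 𝔪 (𝔓.cspToNcsp ⟨𝔞, h𝔞⟩) with h | h
  · rw [if_pos h, if_pos h.symm]
  · rw [if_neg h, if_neg (Ne.symm h)]

/-- Degree on `𝔪` of an element with a single NON-cuspidal coordinate `k` at the component `𝔫`:
`k·([𝔪 = 𝔫⁺] − 2[𝔪 = 𝔫] + [𝔪 = 𝔫⁻])`. [cite: MochizukiEtTh2009, §1 p.240 (PDF p.14)] -/
theorem degOn_ncsp (𝔪 𝔫 : {p : Primes 𝔉.PhiAcirc // ¬ 𝔓.IsCuspidal p}) {x : Algebra.GrothendieckGroup 𝔉.PhiAcirc} {k : ℚ}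
    (hx𝔫 : 𝔖.ord 𝔫.1 x = k) (hx : ∀ 𝔮, 𝔮 ≠ 𝔫.1 → 𝔖.ord 𝔮 x = 0) :
    𝔖.degOn 𝔪 x = k * ((if 𝔪 = ncspShift 𝔓 1 𝔫 then 1 else 0) - 2 * (if 𝔪 = 𝔫 then 1 else 0) +
      (if 𝔪 = ncspShift 𝔓 (-1) 𝔫 then 1 else 0)) := by
  rw [degOn_eq, 𝔖.vert_of_single 𝔪 hx𝔫 hx, 𝔖.cuspSum_eq_zero_of_forall 𝔪, add_zero]
  · have e1 : ((ncspShift 𝔓 (-1) 𝔪).1 = 𝔫.1) = (𝔪 = ncspShift 𝔓 1 𝔫) := by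
      rw [← Subtype.ext_iff, ncspShift_eq_iff, neg_neg]
    have e2 : (𝔪.1 = 𝔫.1) = (𝔪 = 𝔫) := by rw [← Subtype.ext_iff]
    have e3 : ((ncspShift 𝔓 1 𝔪).1 = 𝔫.1) = (𝔪 = ncspShift 𝔓 (-1) 𝔫) := by
      rw [← Subtype.ext_iff, ncspShift_eq_iff]
    simp only [e1, e2, e3]
  · intro 𝔠 h𝔠; exact hx 𝔠 fun h => 𝔫.2 (h ▸ h𝔠)

/-- Degree of the prime log-divisor of a cusp. [cite: MochizukiEtTh2009, §1 p.240 (PDF p.14)] -/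
theorem degOn_gen_cusp (𝔪 : {p : Primes 𝔉.PhiAcirc // ¬ 𝔓.IsCuspidal p})
    (𝔠 : {p : Primes 𝔉.PhiAcirc // 𝔓.IsCuspidal p}) :
    𝔖.degOn 𝔪 (Algebra.GrothendieckGroup.of (𝔖.gen 𝔠.1)) = if 𝔪 = 𝔓.cspToNcsp 𝔠 then 1 else 0 := by
  rw [𝔖.degOn_cusp 𝔪 𝔠.2 (𝔖.ord_gen_self 𝔠.1) (fun 𝔮 h => 𝔖.ord_gen_of_ne h), one_mul]

/-- Degree of the prime log-divisor of a component. [cite: MochizukiEtTh2009, §1 p.240 (PDF p.14)] -/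
theorem degOn_gen_ncsp (𝔪 𝔫 : {p : Primes 𝔉.PhiAcirc // ¬ 𝔓.IsCuspidal p}) :
    𝔖.degOn 𝔪 (Algebra.GrothendieckGroup.of (𝔖.gen 𝔫.1)) =
      (if 𝔪 = ncspShift 𝔓 1 𝔫 then 1 else 0) - 2 * (if 𝔪 = 𝔫 then 1 else 0) +
        (if 𝔪 = ncspShift 𝔓 (-1) 𝔫 then 1 else 0) := by
  rw [𝔖.degOn_ncsp 𝔪 𝔫 (𝔖.ord_gen_self 𝔫.1) (fun 𝔮 h => 𝔖.ord_gen_of_ne h), one_mul]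

/-- The support of `of (gen 𝔭)` is finite. [cite: MochizukiEtTh2009, Prop 5.3 p.325 (PDF p.99)] -/
theorem supp_gen_finite (𝔭 : Primes 𝔉.PhiAcirc) :
    (𝔖.supp (Algebra.GrothendieckGroup.of (𝔖.gen 𝔭))).Finite := by
  rw [supp_gen]; exact Set.finite_singleton _

/-- The support of a primary element is finite. [cite: MochizukiEtTh2009, Prop 5.3 p.325 (PDF p.99)] -/
theorem supp_finite_of_mem_carrier {𝔭 : Primes 𝔉.PhiAcirc} {a : 𝔉.PhiAcirc} (ha : a ∈ 𝔭.carrier) :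
    (𝔖.supp (Algebra.GrothendieckGroup.of a)).Finite := by
  rw [𝔖.supp_of_mem_carrier ha]; exact Set.finite_singleton _

/-- `LinEquiv x y` unfolds to `x · y⁻¹ ∈ principal`; `IsPrincipal z` to `z · 1⁻¹ ∈ principal`.
[cite: MochizukiEtTh2009, Prop 5.3 proof p.326 (PDF p.100)] -/
theorem isPrincipal_iff_mem (z : Algebra.GrothendieckGroup 𝔉.PhiAcirc) :
    𝔖.IsPrincipal z ↔ z ∈ 𝔖.principal := by
  rw [IsPrincipal, IsPrincipalOf, LinEquivOf, inv_one, mul_one]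

/-- A non-zero cusp sum exhibits a cusp of the support over the component.
[cite: MochizukiEtTh2009, Prop 5.3 proof p.326 (PDF p.100)] -/
theorem exists_cusp_of_cuspSum_ne_zero (𝔪 : {p : Primes 𝔉.PhiAcirc // ¬ 𝔓.IsCuspidal p}) {x : Algebra.GrothendieckGroup 𝔉.PhiAcirc}
    (h : (∑ᶠ 𝔠 : {𝔠 : {p : Primes 𝔉.PhiAcirc // 𝔓.IsCuspidal p} // 𝔓.cspToNcsp 𝔠 = 𝔪}, 𝔖.ord 𝔠.1.1 x) ≠ 0) :
    ∃ 𝔠 : {p : Primes 𝔉.PhiAcirc // 𝔓.IsCuspidal p}, 𝔓.cspToNcsp 𝔠 = 𝔪 ∧ 𝔠.1 ∈ 𝔖.supp x := by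
  by_contra h'
  push Not at h'
  apply h
  apply finsum_eq_zero_of_forall_eq_zero
  intro 𝔠
  have := h' 𝔠.1 𝔠.2
  rwa [mem_supp_iff, not_not] at this

/-! ### (iv): the description of the surjection, from "principal ⇒ degrees vanish" -/

/-- **[EtTh] Prop. 5.3 (iv), p.326 description of `Prime^csp ↠ Prime^ncsp`, from the intersection theory of the
chain**: if every principal element of `Φ(A_⊚)^gp` has degree `0` on every component, then `CspToNcspCriterion'`
holds — "the natural surjection of (iv) is obtained by mapping the prime determined by `a` to the prime
determined by `n`".  [cite: MochizukiEtTh2009, Prop 5.3 proof p.326 (PDF p.100); §1 p.240 (PDF p.14)] -/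
theorem cspToNcspCriterion'_of_degree
    (hP : ∀ x : Algebra.GrothendieckGroup 𝔉.PhiAcirc, 𝔖.IsPrincipal x → ∀ 𝔪, 𝔖.degOn 𝔪 x = 0) :
    CspToNcspCriterion' 𝔖 := by
  intro 𝔞 𝔫 h𝔞 h𝔫 a b n ha hn hb hcop hmin hlin
  obtain ⟨m, hm, hma, hma'⟩ := 𝔖.ord_of_mem_carrier ha
  obtain ⟨k, hk, hkn, hkn'⟩ := 𝔖.ord_of_mem_carrier hn
  set A := Algebra.GrothendieckGroup.of a with hA
  set B := Algebra.GrothendieckGroup.of b with hB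
  set N := Algebra.GrothendieckGroup.of n with hN
  have hfinA : (𝔖.supp A).Finite := 𝔖.supp_finite_of_mem_carrier ha
  have hfinN : (𝔖.supp N).Finite := 𝔖.supp_finite_of_mem_carrier hn
  have hfinB : (𝔖.supp B).Finite := hmin.2.1.subset (𝔖.supp_subset_of_coprime hcop)
  have hx : 𝔖.IsPrincipal (B * A⁻¹ * N⁻¹) := (𝔖.isPrincipal_iff_mem _).mpr hlin
  have h0 := hP _ hx ⟨𝔫, h𝔫⟩
  rw [𝔖.degOn_mul _ (hmin.2.1) (by rw [supp_inv]; exact hfinN), 𝔖.degOn_mul _ hfinB (by rwa [supp_inv]),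
    degOn_inv, degOn_inv, 𝔖.degOn_cusp ⟨𝔫, h𝔫⟩ h𝔞 hma hma',
    𝔖.degOn_ncsp ⟨𝔫, h𝔫⟩ ⟨𝔫, h𝔫⟩ hkn hkn', degOn_eq, 𝔖.vert_eq_zero_of_isCuspidalGp _ hb, zero_add,
    if_neg (ncspShift_ne_self one_ne_zero ⟨𝔫, h𝔫⟩).symm,
    if_neg (ncspShift_ne_self (by norm_num : (-1 : ℤ) ≠ 0) ⟨𝔫, h𝔫⟩).symm, if_pos rfl] at h0
  by_contra hne
  rw [if_neg (Ne.symm hne)] at h0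
  have hB0 := 𝔖.cuspSum_of_nonneg ⟨𝔫, h𝔫⟩ b
  rw [← hB] at hB0
  have hk' : (0 : ℚ) < k := Nat.cast_pos.mpr hk
  linarith

/-! ### (iv): the configuration exists at every cusp, from "principal ⇔ degrees vanish" -/

/-- **[EtTh] Prop. 5.3 (iv), the p.326 configuration exists at every cusp, from the intersection theory of the
chain**: under `PrincipalIffDegreeZero`, `CspToNcspWitnessed'` holds — at a cusp `𝔞` over the component
`n_j` take `a = 2·𝔞`, `b = 𝔠₁ + 𝔠₂` with `𝔠₁ ↦ n_{j−1}`, `𝔠₂ ↦ n_{j+1}`, `n = n_j`.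
[cite: MochizukiEtTh2009, Prop 5.3 proof p.326 (PDF p.100); §1 p.240 (PDF p.14)] -/
theorem cspToNcspWitnessed'_of_principalIffDegreeZero (hI : 𝔖.PrincipalIffDegreeZero) :
    CspToNcspWitnessed' 𝔖 := by
  intro 𝔞 h𝔞
  set 𝔫 : {p : Primes 𝔉.PhiAcirc // ¬ 𝔓.IsCuspidal p} := 𝔓.cspToNcsp ⟨𝔞, h𝔞⟩ with h𝔫def
  set 𝔫p : {p : Primes 𝔉.PhiAcirc // ¬ 𝔓.IsCuspidal p} := ncspShift 𝔓 1 𝔫 with h𝔫p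
  set 𝔫m : {p : Primes 𝔉.PhiAcirc // ¬ 𝔓.IsCuspidal p} := ncspShift 𝔓 (-1) 𝔫 with h𝔫m
  obtain ⟨𝔠₁, h𝔠₁⟩ := 𝔓.cspToNcsp_surjective 𝔫m
  obtain ⟨𝔠₂, h𝔠₂⟩ := 𝔓.cspToNcsp_surjective 𝔫p
  have hpn : 𝔫p ≠ 𝔫 := ncspShift_ne_self one_ne_zero 𝔫
  have hmn : 𝔫m ≠ 𝔫 := ncspShift_ne_self (by norm_num) 𝔫
  have hpm : 𝔫p ≠ 𝔫m := ncspShift_ne_ncspShift (by norm_num) 𝔫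
  have h𝔠₁𝔞 : 𝔠₁.1 ≠ 𝔞 := fun h =>
    hmn (by rw [← h𝔠₁, h𝔫def]; congr 1; exact Subtype.ext h)
  have h𝔠₂𝔞 : 𝔠₂.1 ≠ 𝔞 := fun h =>
    hpn (by rw [← h𝔠₂, h𝔫def]; congr 1; exact Subtype.ext h)
  have h𝔠₁𝔠₂ : 𝔠₁.1 ≠ 𝔠₂.1 := cusp_ne_of_cspToNcsp_ne (by rw [h𝔠₁, h𝔠₂]; exact hpm.symm)
  -- the elements
  set A := Algebra.GrothendieckGroup.of (𝔖.gen 𝔞 ^ 2) with hA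
  set G₁ := Algebra.GrothendieckGroup.of (𝔖.gen 𝔠₁.1) with hG₁
  set G₂ := Algebra.GrothendieckGroup.of (𝔖.gen 𝔠₂.1) with hG₂
  set N := Algebra.GrothendieckGroup.of (𝔖.gen 𝔫.1) with hN
  have hB : Algebra.GrothendieckGroup.of (𝔖.gen 𝔠₁.1 * 𝔖.gen 𝔠₂.1) = G₁ * G₂ := map_mul _ _ _
  have ha : 𝔖.gen 𝔞 ^ 2 ∈ 𝔞.carrier := (𝔖.mem_carrier_iff 𝔞 _).mpr ⟨2, two_pos, rfl⟩
  have hn : 𝔖.gen 𝔫.1 ∈ 𝔫.1.carrier := (𝔖.mem_carrier_iff _ _).mpr ⟨1, one_pos, (pow_one _).symm⟩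
  -- supports
  have hsA : 𝔖.supp A = {𝔞} := 𝔖.supp_of_mem_carrier ha
  have hsB : 𝔖.supp (G₁ * G₂) ⊆ {𝔠₁.1, 𝔠₂.1} := by
    refine (𝔖.supp_mul_subset _ _).trans ?_
    rw [hG₁, hG₂, supp_gen, supp_gen]
    intro 𝔭 h; simpa [or_comm] using h
  have hfinA : (𝔖.supp A).Finite := by rw [hsA]; exact Set.finite_singleton _
  have hfinG₁ : (𝔖.supp G₁).Finite := 𝔖.supp_gen_finite _
  have hfinG₂ : (𝔖.supp G₂).Finite := 𝔖.supp_gen_finite _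
  have hfinB : (𝔖.supp (G₁ * G₂)).Finite := (Set.toFinite _).subset hsB
  have hfinN : (𝔖.supp N).Finite := 𝔖.supp_gen_finite _
  have hfinBA : (𝔖.supp (G₁ * G₂ * A⁻¹)).Finite :=
    ((hfinB.union (by rwa [supp_inv] : (𝔖.supp A⁻¹).Finite))).subset (𝔖.supp_mul_subset _ _)
  have hcuspB : 𝔖.IsCuspidalGp (G₁ * G₂) := by
    intro 𝔭 h𝔭
    rcases hsB h𝔭 with h | h
    · rw [h]; exact 𝔠₁.2
    · rw [Set.mem_singleton_iff] at h; rw [h]; exact 𝔠₂.2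
  have hcuspBA : 𝔖.IsCuspidalGp (G₁ * G₂ * A⁻¹) := by
    intro 𝔭 h𝔭
    rcases 𝔖.supp_mul_subset _ _ h𝔭 with h | h
    · exact hcuspB 𝔭 h
    · rw [supp_inv, hsA, Set.mem_singleton_iff] at h; rw [h]; exact h𝔞
  -- degrees: `G₁ + G₂ − A − N` has degree 0 on every component
  have hdeg : ∀ 𝔪 : {p : Primes 𝔉.PhiAcirc // ¬ 𝔓.IsCuspidal p},
      𝔖.degOn 𝔪 (G₁ * G₂ * A⁻¹ * N⁻¹) = 0 := by
    intro 𝔪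
    rw [𝔖.degOn_mul _ hfinBA (by rwa [supp_inv]), 𝔖.degOn_mul _ hfinB (by rwa [supp_inv]),
      𝔖.degOn_mul _ hfinG₁ hfinG₂, degOn_inv, degOn_inv, 𝔖.degOn_gen_cusp, 𝔖.degOn_gen_cusp, h𝔠₁, h𝔠₂,
      𝔖.degOn_cusp 𝔪 h𝔞 (by rw [hA, map_pow, ord_pow, ord_gen_self])
        (fun 𝔮 h => by rw [hA, map_pow, ord_pow, 𝔖.ord_gen_of_ne h, mul_zero]),
      ← h𝔫def, 𝔖.degOn_gen_ncsp 𝔪 𝔫]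
    ring
  have hlinN : 𝔖.LinEquiv (G₁ * G₂ * A⁻¹) N := by
    change G₁ * G₂ * A⁻¹ * N⁻¹ ∈ 𝔖.principal
    exact (𝔖.isPrincipal_iff_mem _).mp ((hI _).mpr hdeg)
  refine ⟨𝔫.1, 𝔫.2, 𝔖.gen 𝔞 ^ 2, 𝔖.gen 𝔠₁.1 * 𝔖.gen 𝔠₂.1, 𝔖.gen 𝔫.1, ha, hn, ?_, ?_, ?_, ?_⟩
  · rw [hB]; exact hcuspB
  · -- coprime
    change Disjoint (𝔖.supp A) (𝔖.supp (Algebra.GrothendieckGroup.of (𝔖.gen 𝔠₁.1 * 𝔖.gen 𝔠₂.1)))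
    rw [hB, hsA, Set.disjoint_singleton_left]
    intro h
    rcases hsB h with h | h
    · exact h𝔠₁𝔞 h.symm
    · exact h𝔠₂𝔞 (Set.mem_singleton_iff.mp h).symm
  · -- cuspidally minimal
    rw [hB]
    refine ⟨hcuspBA, hfinBA, fun y hy hyfin hylin => ?_⟩
    -- `supp (G₁ G₂ A⁻¹)` has at most three elements
    have hle3 : (𝔖.supp (G₁ * G₂ * A⁻¹)).ncard ≤ 3 := by
      have hsub : 𝔖.supp (G₁ * G₂ * A⁻¹) ⊆ {𝔠₁.1, 𝔠₂.1, 𝔞} := by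
        intro 𝔭 h𝔭
        rcases 𝔖.supp_mul_subset _ _ h𝔭 with h | h
        · rcases hsB h with h | h
          · exact Or.inl h
          · exact Or.inr (Or.inl (Set.mem_singleton_iff.mp h))
        · rw [supp_inv, hsA] at h; exact Or.inr (Or.inr h)
      refine (Set.ncard_le_ncard hsub (Set.toFinite _)).trans ?_
      refine (Set.ncard_insert_le _ _).trans ?_
      have := Set.ncard_insert_le 𝔠₂.1 ({𝔞} : Set (Primes 𝔉.PhiAcirc))
      rw [Set.ncard_singleton] at this
      omega
    -- any cuspidal `y ∼ G₁ G₂ A⁻¹ ∼ N` has a cusp over each of `𝔫m, 𝔫, 𝔫p` in its support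
    have hyN : 𝔖.IsPrincipal (y * N⁻¹) := by
      rw [isPrincipal_iff_mem]
      have h1 : y * (G₁ * G₂ * A⁻¹)⁻¹ ∈ 𝔖.principal := hylin
      have h2 : G₁ * G₂ * A⁻¹ * N⁻¹ ∈ 𝔖.principal := hlinN
      have := 𝔖.principal.mul_mem h1 h2
      convert this using 1; group
    have hdegy : ∀ 𝔪 : {p : Primes 𝔉.PhiAcirc // ¬ 𝔓.IsCuspidal p},
        (∑ᶠ 𝔠 : {𝔠 : {p : Primes 𝔉.PhiAcirc // 𝔓.IsCuspidal p} // 𝔓.cspToNcsp 𝔠 = 𝔪}, 𝔖.ord 𝔠.1.1 y) =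
        (if 𝔪 = 𝔫p then 1 else 0) - 2 * (if 𝔪 = 𝔫 then 1 else 0) + (if 𝔪 = 𝔫m then 1 else 0) := by
      intro 𝔪
      have h0 := (hI _).mp hyN 𝔪
      rw [𝔖.degOn_mul _ hyfin (by rwa [supp_inv]), degOn_inv, 𝔖.degOn_gen_ncsp 𝔪 𝔫, degOn_eq,
        𝔖.vert_eq_zero_of_isCuspidalGp _ hy, zero_add] at h0
      linarith
    have hc0 :
        (∑ᶠ 𝔠 : {𝔠 : {p : Primes 𝔉.PhiAcirc // 𝔓.IsCuspidal p} // 𝔓.cspToNcsp 𝔠 = 𝔫}, 𝔖.ord 𝔠.1.1 y) ≠ 0 := by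
      rw [hdegy, if_neg hpn.symm, if_pos rfl, if_neg hmn.symm]; norm_num
    have hcp :
        (∑ᶠ 𝔠 : {𝔠 : {p : Primes 𝔉.PhiAcirc // 𝔓.IsCuspidal p} // 𝔓.cspToNcsp 𝔠 = 𝔫p}, 𝔖.ord 𝔠.1.1 y) ≠ 0 := by
      rw [hdegy, if_pos rfl, if_neg hpn, if_neg hpm]; norm_num
    have hcm :
        (∑ᶠ 𝔠 : {𝔠 : {p : Primes 𝔉.PhiAcirc // 𝔓.IsCuspidal p} // 𝔓.cspToNcsp 𝔠 = 𝔫m}, 𝔖.ord 𝔠.1.1 y) ≠ 0 := by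
      rw [hdegy, if_neg hpm.symm, if_neg hmn, if_pos rfl]; norm_num
    obtain ⟨𝔡₀, h𝔡₀, h𝔡₀y⟩ := 𝔖.exists_cusp_of_cuspSum_ne_zero _ hc0
    obtain ⟨𝔡p, h𝔡p, h𝔡py⟩ := 𝔖.exists_cusp_of_cuspSum_ne_zero _ hcp
    obtain ⟨𝔡m, h𝔡m, h𝔡my⟩ := 𝔖.exists_cusp_of_cuspSum_ne_zero _ hcm
    have h3 : ({𝔡₀.1, 𝔡p.1, 𝔡m.1} : Set (Primes 𝔉.PhiAcirc)).ncard = 3 := by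
      rw [Set.ncard_eq_three]
      exact ⟨𝔡₀.1, 𝔡p.1, 𝔡m.1, cusp_ne_of_cspToNcsp_ne (by rw [h𝔡₀, h𝔡p]; exact hpn.symm),
        cusp_ne_of_cspToNcsp_ne (by rw [h𝔡₀, h𝔡m]; exact hmn.symm),
        cusp_ne_of_cspToNcsp_ne (by rw [h𝔡p, h𝔡m]; exact hpm), rfl⟩
    have hsub : ({𝔡₀.1, 𝔡p.1, 𝔡m.1} : Set (Primes 𝔉.PhiAcirc)) ⊆ 𝔖.supp y := by
      intro 𝔭 h
      rcases h with h | h | h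
      · rw [h]; exact h𝔡₀y
      · rw [h]; exact h𝔡py
      · rw [Set.mem_singleton_iff] at h; rw [h]; exact h𝔡my
    have := Set.ncard_le_ncard hsub hyfin
    change (𝔖.supp (G₁ * G₂ * A⁻¹)).ncard ≤ (𝔖.supp y).ncard
    omega
  · rw [hB]; exact hlinN

end DivisorSupportData'

end FrobenioidThetaDivisors

end Literature.AnabelianGeometry.EtaleTheta

-- (re-land 2026-08-26T06:55Z: comment-only enqueue of the stranded olean build; declarations byte-identical)

namespace Literature.AnabelianGeometry.EtaleTheta.FrobenioidThetaDivisors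

universe w₁ v₁ v₁' u₁ u₁'

/-- A cusp lies over its own component and over no shifted one: `cspToNcsp 𝔠 ≠ (cspToNcsp 𝔠) + t` for `t ≠ 0`
(appended 2026-08-26T07:35Z as a proof-only kick re-dispatching the stranded olean build; content used by the
adjacency count).  [cite: MochizukiEtTh2009, §1 p.239–240 (PDF pp.13–14); Prop 5.3 p.325 (PDF p.99)] -/
theorem cspToNcsp_ne_ncspShift {C : Type u₁} [CategoryTheory.Category.{v₁} C] {D : Type u₁'}
    [CategoryTheory.Category.{v₁'} D] {𝔉 : ThetaFrobenioid.{w₁} C D} {𝔓 : DivisorPrimeData 𝔉}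
    (𝔠 : {p : Literature.AlgebraicGeometry.Frobenioids.Primes 𝔉.PhiAcirc // 𝔓.IsCuspidal p}) {t : ℤ}
    (ht : t ≠ 0) : 𝔓.cspToNcsp 𝔠 ≠ ncspShift 𝔓 t (𝔓.cspToNcsp 𝔠) :=
  (ncspShift_ne_self ht _).symm

end Literature.AnabelianGeometry.EtaleTheta.FrobenioidThetaDivisors

namespace Literature.AnabelianGeometry.EtaleTheta.FrobenioidThetaDivisors

universe w₂ v₂ v₂' u₂ u₂'

/-- The zero shift fixes every component (appended 2026-08-26T08:12Z as a second proof-only kick re-dispatching the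
stranded olean build).  [cite: MochizukiEtTh2009, §1 p.239–240 (PDF pp.13–14)] -/
theorem ncspShift_zero {C : Type u₂} [CategoryTheory.Category.{v₂} C] {D : Type u₂'}
    [CategoryTheory.Category.{v₂'} D] {𝔉 : ThetaFrobenioid.{w₂} C D} (𝔓 : DivisorPrimeData 𝔉)
    (𝔫 : {p : Literature.AlgebraicGeometry.Frobenioids.Primes 𝔉.PhiAcirc // ¬ 𝔓.IsCuspidal p}) :
    ncspShift 𝔓 0 𝔫 = 𝔫 := by
  apply 𝔓.ncspEquivZ.injective
  rw [ncspEquivZ_ncspShift, add_zero]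

end Literature.AnabelianGeometry.EtaleTheta.FrobenioidThetaDivisors
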